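/-
Copyright (c) 2026 the pub-hodgecm-mathlib formalisation cell (harness21).  Prover seat hodgecm-mathlib-R90-C10-p05 (g2), R90-TF SLAB section S1 «Ch10-local» (base
R90-C10), h413 = `stmt-HodgeConjecture-24833`; line «B_pos» (U4Keys :182 in BRANCH B at positive depth, memo `R90/R90-C10-p05/g2/DESIGN-Bpos-inert.md`, RULING R-S1-12∕un-cross
23:40:20Z of the S1 chair R90-C10-plan (g2): «(B-1) is p05's»): brick (B-1), GENERIC half — «THE NORMALISED `(K, θ)`-TYPE BASIS `(f₁, f_w)` WITHOUT A TWO-CELL COVER»: Mackey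
(★ (M3)) over the FULL double-coset space `H∖G∕K`, so that the level group `K = J_e` (infinitely many cells) is admitted.  2026-09-05.
-/
import Summits.HodgeConjecture.HodgeConjecture.Theorems.K2E3IwahoriTypeBasisMackey     -- ★ (K2E3-p32 (g0)): `theta_mul_theta_inv_eq_one`, the two-cell version; brings ★ (M3) `Representation.exists_intertwiningMap_forall_toFun_eq`, ★ V2 `apply_eq_mul_one`, ★ `Representation.SmoothInd`
import Mathlib.GroupTheory.DoubleCoset
import HarnessLib

/-!
# R90-TF S1 «Ch10-local» ∕ K2 E3 «U4Keys» :182, BRANCH B AT POSITIVE DEPTH — brick (B-1), generic half: THE NORMALISED `(K, θ)`-TYPE BASIS OF `Ind_H^G τ` FOR AN OPEN `K`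
# WITH ARBITRARILY MANY `(H, K)`-DOUBLE COSETS   [BernsteinZelevinsky1977 §2.3; Roche1998 §3–§4; Casselman1995 §6.3; Bump1997 Ex. 4.5.5]

Cell `pub/hodgecm-mathlib`, crux H413 = `stmt-HodgeConjecture-24833`, route of record `HCCMUnconditional` (no route verbs); R90-TF section S1 (junction socket A2′ = U4Keys :217,
REL over :155 and :182).  THEOREMS ONLY (no `def`, no `instance`, no `notation`, no named-fact hypothesis, no `sorry`); lane `--supports stmt-HodgeConjecture-24833 --as helper`,
count-neutral.  GENERIC: a topological group `G`, subgroups `H` (= `P`) and `K` (= `J_e`), a one-dimensional `τ` of `H`, a multiplier `θ : G → ℂ`, an element `g₀` (= `w₀`).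
NOT THE PAYER of :182.

THE POINT.  ★ `K2E3IwahoriTypeBasisMackey.exists_typeVector_of_local` (and its corollaries `exists_typeVector_supported_one ∕ _weyl`, `exists_normalised_typeBasis`) build the
`(K, θ)`-type vectors `f₁` (supported on `H·K`, `f₁(1) = 1, f₁(g₀) = 0`) and `f_w` (supported on `H·g₀·K`, `f_w(1) = 0, f_w(g₀) = 1`) by MACKEY ★ (M3) over the TWO-CELL cover
`G = H·K ⊔ H·g₀·K` — true for the Iwahori, FALSE for a two-depth level group `J_e` (intermediate cells).  But ★ (M3) `Representation.exists_intertwiningMap_forall_toFun_eq` is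
indexed by an ARBITRARY type `ι`: take `ι := H∖G∕K` (Mathlib `DoubleCoset.Quotient`), representatives `g q := 1` on the class of `1`, `g₀` on the class of `g₀`, `q.out` elsewhere
(cover and disjointness are then TAUTOLOGICAL, Mathlib `DoubleCoset.eq`, `DoubleCoset.out_eq'`), and local intertwiners `z ↦ cᵢ z` with `c = c₀` on the class of `1`, `c₁` on the
class of `g₀` and `0` on every other class (the zero map intertwines anything).  The only hypotheses left are the ones that matter: `K` open, `θ` multiplicative on `K` with
`θ 1 = 1` and `θ = 1` on an open subgroup `C`, `g₀ ∉ H·K`, and the two weighted local compatibilities `c₀·(θ s − τ s) = 0` on `K ∩ H`, `c₁·(θ s − τ(g₀ s g₀⁻¹)) = 0` on `K ∩ g₀⁻¹Hg₀`.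
* §1 `rep_mk_eq` (the class of each representative is the class itself), `exists_typeVector_of_local_of_cells` (prescribed values `c₀` at `1`, `c₁` at `g₀`).
* §2 **`exists_typeVector_supported_one_of_cells`**, **`exists_typeVector_supported_weyl_of_cells`**, **`exists_normalised_typeBasis_of_cells`** — the basis `(f₁, f_w)`, cover-free.
With ★ (B-0) `R90S1BranchBDeterminantVanishingCells` (cell-family `det M = 0`) and ★ (B-2b)∕(B-2b′) (the cover and the shell witnesses at `J_e`), this is the last GENERIC input of
«reducible ⟹ `det M = 0`» at positive depth; the CM instantiation at `J_e` on `U(Φ₃)(L⁺_v)` is brick (B-1′).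
HONEST LABEL.  HC_CM is proved only modulo the 7 printed citations (2 remaining named inputs: hLiu418 = `stmt-HodgeConjecture-24832`, h413 = `stmt-HodgeConjecture-24833`) until rung 0
closes; count-neutral — this file does NOT pay :182 or A2′; no printed citation is discharged.

## References
* [BernsteinZelevinsky1977] I. N. Bernstein, A. V. Zelevinsky, *Induced representations of reductive p-adic groups I*, Ann. Sci. ÉNS 10 (1977), §2.3 (Mackey on double cosets).
* [Roche1998] A. Roche, *Types and Hecke algebras for principal series representations of split reductive p-adic groups*, Ann. Sci. ÉNS (4) 31 (1998), §3–§4 (`χ̃`-spherical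
  vectors supported on `P g J_χ`; `|W_χ| = 2` relevant cells in Branch B).
* [Casselman1995] W. Casselman, *Introduction to the theory of admissible representations of `p`-adic reductive groups* (1995), §6.3.
* [Bump1997] D. Bump, *Automorphic Forms and Representations* (1997), Exercise 4.5.5 (Mackey theory for compact open subgroups).
-/

set_option autoImplicit false
-- the mandated namespace has the single-problem summit's repeated segment (`HodgeConjecture.HodgeConjecture`)
set_option linter.dupNamespace false

noncomputable section

namespace Summit.HodgeConjecture.HodgeConjecture.R90.S1.BposTypeBasisCells

open Summit.HodgeConjecture.HodgeConjecture.Cruxes.H413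
open Literature.NumberTheory.Automorphic Representation

variable {G : Type*} [Group G] [TopologicalSpace G] [IsTopologicalGroup G] (H : Subgroup G) (τ : Representation ℂ ↥H ℂ)

/-! ## §1 Mackey over the full double-coset space with three kinds of representatives -/

omit [TopologicalSpace G] [IsTopologicalGroup G] in
/-- The chosen representative of a double coset (`1` on the class of `1`, `g₀` on the class of `g₀`, `Quotient.out` elsewhere) represents that coset. [cite: BernsteinZelevinsky1977, §2.3] -/
theorem rep_mk_eq (K : Subgroup G) [DecidableEq (DoubleCoset.Quotient (H : Set G) K)] (g₀ : G) (q : DoubleCoset.Quotient (H : Set G) K) :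
    DoubleCoset.mk H K (if q = DoubleCoset.mk H K 1 then (1 : G) else if q = DoubleCoset.mk H K g₀ then g₀ else q.out) = q := by
  by_cases h1 : q = DoubleCoset.mk H K 1
  · rw [if_pos h1, h1]
  · rw [if_neg h1]
    by_cases h2 : q = DoubleCoset.mk H K g₀
    · rw [if_pos h2, h2]
    · rw [if_neg h2]
      exact DoubleCoset.out_eq' H K q

/-- **MACKEY FOR A `(K, θ)`-TYPE VECTOR WITH PRESCRIBED VALUES AT `1` AND `g₀`, COVER-FREE.**  `K` open; `θ` multiplicative on `K`, `θ 1 = 1`, `θ = 1` on an open subgroup `C`; `g₀ ∉ H·K`.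
Given `c₀ · (θ s − τ s) = 0` for `s ∈ K ∩ H` and `c₁ · (θ s − τ(g₀ s g₀⁻¹)) = 0` for `s ∈ K ∩ g₀⁻¹Hg₀`, there is a `(K, θ)`-eigen-section `f` of `Ind_H^G τ` with `f(1) = c₀`, `f(g₀) = c₁`
(and `f = 0` on every other double coset, by construction — not recorded).  ★ (M3) over `ι := H∖G∕K`. [cite: BernsteinZelevinsky1977, §2.3] [cite: Roche1998, §3–§4]
[cite: Bump1997, Exercise 4.5.5] -/
theorem exists_typeVector_of_local_of_cells (K : Subgroup G) (hKo : IsOpen (K : Set G)) (θ : G → ℂ)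
    (hθmul : ∀ x ∈ K, ∀ y ∈ K, θ (x * y) = θ x * θ y) (hθone : θ 1 = 1)
    (C : Subgroup G) (hCo : IsOpen (C : Set G)) (hθC : ∀ c ∈ C, θ c = 1)
    (g₀ : G) (hg₀ : ¬ ∃ h ∈ H, ∃ b ∈ K, g₀ = h * b)
    (c₀ c₁ : ℂ)
    (hθH : ∀ (s : G), s ∈ K → ∀ hsH : s ∈ H, c₀ * θ s = c₀ * τ ⟨s, hsH⟩ 1)
    (hθw : ∀ (s : G), s ∈ K → ∀ hsH : g₀ * s * g₀⁻¹ ∈ H, c₁ * θ s = c₁ * τ ⟨g₀ * s * g₀⁻¹, hsH⟩ 1) :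
    ∃ f : Representation.SmoothInd H τ, (∀ x ∈ K, Representation.smoothIndRep H τ x f = θ x • f) ∧ f.toFun 1 = c₀ ∧ f.toFun g₀ = c₁ := by
  classical
  -- `θ` as a character `θK` of `K`, and the line `ℂ_θ` (`E`)
  have hunit : ∀ x : ↥K, θ (x : G) * θ ((x : G))⁻¹ = 1 := fun x => K2E3IwahoriTypeBasisMackey.theta_mul_theta_inv_eq_one K θ hθmul hθone x.2
  let θK : ↥K →* ℂˣ :=
    { toFun := fun x => ⟨θ (x : G), θ ((x : G))⁻¹, hunit x, by rw [mul_comm]; exact hunit x⟩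
      map_one' := Units.ext hθone
      map_mul' := fun x y => Units.ext (hθmul x x.2 y y.2) }
  let E : Representation ℂ ↥K ℂ := (Representation.trivial ℂ ↥K ℂ).twist θK
  have hE : ∀ (x : ↥K) (z : ℂ), E x z = θ (x : G) * z := fun x z => by
    simp [E, θK, Representation.twist]
  -- `ℂ_θ` is smooth: `C` is open and acts trivially
  have hEs : E.IsSmooth := by
    intro z
    refine Representation.isSmoothVector_of_le E (K := C.subgroupOf K) ?_ (fun x hx => ?_)
    · rw [Subgroup.coe_subgroupOf]
      exact hCo.preimage continuous_subtype_val
    · rw [Representation.mem_stabilizerSubgroup, hE, hθC _ (Subgroup.mem_subgroupOf.1 hx), one_mul]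
  -- the index set `ι = H∖G∕K` and the representatives
  let g : DoubleCoset.Quotient (H : Set G) K → G := fun q =>
    if q = DoubleCoset.mk H K 1 then (1 : G) else if q = DoubleCoset.mk H K g₀ then g₀ else q.out
  have hg_mk : ∀ q, DoubleCoset.mk H K (g q) = q := fun q => rep_mk_eq H K g₀ q
  have hg_one : g (DoubleCoset.mk H K 1) = 1 := by simp [g]
  have hne : DoubleCoset.mk H K g₀ ≠ DoubleCoset.mk H K 1 := by
    intro h
    obtain ⟨a, ha, b, hb, hab⟩ := (DoubleCoset.eq H K g₀ 1).1 h
    -- `1 = a g₀ b` ⟹ `g₀ = a⁻¹ b⁻¹ ∈ H·K`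
    refine hg₀ ⟨a⁻¹, H.inv_mem ha, b⁻¹, K.inv_mem hb, ?_⟩
    calc g₀ = a⁻¹ * (a * g₀ * b) * b⁻¹ := by group
      _ = a⁻¹ * b⁻¹ := by rw [← hab, mul_one]
  have hg_w : g (DoubleCoset.mk H K g₀) = g₀ := by simp [g, hne]
  -- cover and disjointness are tautological
  have hcover' : ∀ y : G, ∃ i, ∃ h : ↥H, ∃ κ ∈ K, y = (h : G) * g i * κ := by
    intro y
    obtain ⟨a, ha, b, hb, hab⟩ := (DoubleCoset.eq H K (g (DoubleCoset.mk H K y)) y).1 (by rw [hg_mk])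
    exact ⟨DoubleCoset.mk H K y, ⟨a, ha⟩, b, hb, hab⟩
  have hdisj' : ∀ i j, (∃ h : ↥H, ∃ κ ∈ K, g j = (h : G) * g i * κ) → i = j := by
    intro i j hij
    obtain ⟨h, κ, hκ, he⟩ := hij
    have hq : DoubleCoset.mk H K (g i) = DoubleCoset.mk H K (g j) := (DoubleCoset.eq H K (g i) (g j)).2 ⟨h, h.2, κ, hκ, he⟩
    rwa [hg_mk, hg_mk] at hq
  -- the local groups `S_i = K ∩ gᵢ⁻¹ H gᵢ` and local targets `τ^{gᵢ}`
  let ψ : ∀ i : DoubleCoset.Quotient (H : Set G) K, ↥((H.map (MulAut.conj (g i)⁻¹).toMonoidHom).subgroupOf K) →* ↥H := fun i =>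
    { toFun := fun s => ⟨(g i) * ((s : ↥K) : G) * (g i)⁻¹, (Representation.mem_subgroupOf_map_conj_inv_iff H K _ (s : ↥K)).1 s.2⟩
      map_one' := Subtype.ext (by simp)
      map_mul' := fun a b => Subtype.ext (by
        change _ * (((a * b : ↥((H.map (MulAut.conj (g i)⁻¹).toMonoidHom).subgroupOf K)) : ↥K) : G) * _ =
          (_ * ((a : ↥K) : G) * _) * (_ * ((b : ↥K) : G) * _)
        rw [Subgroup.coe_mul, Subgroup.coe_mul]
        group) }
  let σc : ∀ i : DoubleCoset.Quotient (H : Set G) K, Representation ℂ ↥((H.map (MulAut.conj (g i)⁻¹).toMonoidHom).subgroupOf K) ℂ := fun i => τ.comp (ψ i)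
  have hσc : ∀ (i : DoubleCoset.Quotient (H : Set G) K) (s : ↥((H.map (MulAut.conj (g i)⁻¹).toMonoidHom).subgroupOf K)),
      σc i s = τ ⟨(g i) * ((s : ↥K) : G) * (g i)⁻¹, (Representation.mem_subgroupOf_map_conj_inv_iff H K _ (s : ↥K)).1 s.2⟩ :=
    fun i s => rfl
  -- the prescribed values: `c₀` on the class of `1`, `c₁` on the class of `g₀`, `0` elsewhere; the local compatibilities
  let c : DoubleCoset.Quotient (H : Set G) K → ℂ := fun q =>
    if q = DoubleCoset.mk H K 1 then c₀ else if q = DoubleCoset.mk H K g₀ then c₁ else 0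
  have hc_one : c (DoubleCoset.mk H K 1) = c₀ := by simp [c]
  have hc_w : c (DoubleCoset.mk H K g₀) = c₁ := by simp [c, hne]
  have hc : ∀ (i : DoubleCoset.Quotient (H : Set G) K) (s : ↥K) (hsH : (g i) * (s : G) * (g i)⁻¹ ∈ H),
      c i * θ (s : G) = c i * τ ⟨(g i) * (s : G) * (g i)⁻¹, hsH⟩ 1 := by
    intro i s hsH
    by_cases h1 : i = DoubleCoset.mk H K 1
    · subst h1
      have hsH' : (s : G) ∈ H := by simpa [hg_one] using hsH
      have heq : τ (⟨(g (DoubleCoset.mk H K 1)) * (s : G) * (g (DoubleCoset.mk H K 1))⁻¹, hsH⟩ : ↥H) = τ ⟨(s : G), hsH'⟩ := by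
        congr 1; exact Subtype.ext (by simp [hg_one])
      rw [heq, hc_one]
      exact hθH s s.2 hsH'
    · by_cases h2 : i = DoubleCoset.mk H K g₀
      · subst h2
        have hsH' : g₀ * (s : G) * g₀⁻¹ ∈ H := by simpa [hg_w] using hsH
        have heq : τ (⟨(g (DoubleCoset.mk H K g₀)) * (s : G) * (g (DoubleCoset.mk H K g₀))⁻¹, hsH⟩ : ↥H) = τ ⟨g₀ * (s : G) * g₀⁻¹, hsH'⟩ := by
          congr 1; exact Subtype.ext (by simp [hg_w])
        rw [heq, hc_w]
        exact hθw s s.2 hsH'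
      · have hci : c i = 0 := by simp [c, h1, h2]
        rw [hci, zero_mul, zero_mul]
  -- the local intertwiners `z ↦ cᵢ z`
  have hφ : ∀ (i : DoubleCoset.Quotient (H : Set G) K) (s : ↥((H.map (MulAut.conj (g i)⁻¹).toMonoidHom).subgroupOf K)) (z : ℂ),
      (c i • (LinearMap.id : ℂ →ₗ[ℂ] ℂ)) ((E.comp ((H.map (MulAut.conj (g i)⁻¹).toMonoidHom).subgroupOf K).subtype) s z) =
        σc i s ((c i • (LinearMap.id : ℂ →ₗ[ℂ] ℂ)) z) := by
    intro i s z
    rw [hσc i s, LinearMap.smul_apply, LinearMap.smul_apply, LinearMap.id_apply, LinearMap.id_apply, smul_eq_mul, smul_eq_mul, MonoidHom.comp_apply,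
      Subgroup.coe_subtype, hE, K2E3TypeVectorOfSubrep.apply_eq_mul_one H τ _ (c i * z)]
    have h := hc i (s : ↥K) ((Representation.mem_subgroupOf_map_conj_inv_iff H K _ (s : ↥K)).1 s.2)
    calc c i * (θ ((s : ↥K) : G) * z) = (c i * θ ((s : ↥K) : G)) * z := by ring
      _ = (c i * τ ⟨(g i) * ((s : ↥K) : G) * (g i)⁻¹, (Representation.mem_subgroupOf_map_conj_inv_iff H K _ (s : ↥K)).1 s.2⟩ 1) * z := by rw [h]
      _ = _ := by ring
  let φ : ∀ i : DoubleCoset.Quotient (H : Set G) K,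
      IntertwiningMap (E.comp ((H.map (MulAut.conj (g i)⁻¹).toMonoidHom).subgroupOf K).subtype) (σc i) := fun i =>
    LinearMap.intertwiningMap_of_isIntertwiningMap _ _ (c i • (LinearMap.id : ℂ →ₗ[ℂ] ℂ)) (hφ i)
  have hφapply : ∀ (i : DoubleCoset.Quotient (H : Set G) K) (z : ℂ), φ i z = c i * z := fun i z => rfl
  -- MACKEY (M3)
  obtain ⟨Φ, hΦ, -⟩ := Representation.exists_intertwiningMap_forall_toFun_eq (H := H) (K := K) (σ := τ) (τ := E) hKo hEs hcover' hdisj' σc hσc φ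
  refine ⟨Φ 1, fun x hx => ?_, ?_, ?_⟩
  · -- `(K, θ)`-eigen
    have h := IntertwiningMap.isIntertwining _ _ Φ (⟨x, hx⟩ : ↥K) (1 : ℂ)
    rw [MonoidHom.comp_apply, Subgroup.coe_subtype, hE, mul_one] at h
    rw [← h, show (θ x : ℂ) = θ x • (1 : ℂ) by rw [smul_eq_mul, mul_one], map_smul, smul_eq_mul, mul_one]
  · rw [← hg_one, hΦ _ 1, hφapply, hc_one, mul_one]
  · have h := hΦ (DoubleCoset.mk H K g₀) 1
    rw [hφapply, hc_w, mul_one, hg_w] at h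
    exact h

/-! ## §2 The type vector on each of the two relevant cells; the normalised type basis -/

/-- **`f₁`: THE `(K, θ)`-TYPE VECTOR WITH `f₁(1) = 1`, `f₁(g₀) = 0`**, cover-free (only the compatibility `θ = τ` on `K ∩ H` is needed: Branches A and B alike).
[cite: Roche1998, §3–§4] [cite: Casselman1995, §6.3] -/
theorem exists_typeVector_supported_one_of_cells (K : Subgroup G) (hKo : IsOpen (K : Set G)) (θ : G → ℂ)
    (hθmul : ∀ x ∈ K, ∀ y ∈ K, θ (x * y) = θ x * θ y) (hθone : θ 1 = 1)
    (C : Subgroup G) (hCo : IsOpen (C : Set G)) (hθC : ∀ c ∈ C, θ c = 1)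
    (g₀ : G) (hg₀ : ¬ ∃ h ∈ H, ∃ b ∈ K, g₀ = h * b)
    (hθH : ∀ (s : G), s ∈ K → ∀ hsH : s ∈ H, θ s = τ ⟨s, hsH⟩ 1) :
    ∃ f₁ : Representation.SmoothInd H τ, (∀ x ∈ K, Representation.smoothIndRep H τ x f₁ = θ x • f₁) ∧ f₁.toFun 1 = 1 ∧ f₁.toFun g₀ = 0 :=
  exists_typeVector_of_local_of_cells H τ K hKo θ hθmul hθone C hCo hθC g₀ hg₀ 1 0 (fun s hs hsH => by rw [hθH s hs hsH])
    (fun _ _ _ => by rw [zero_mul, zero_mul])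

/-- **`f_w`: THE `(K, θ)`-TYPE VECTOR WITH `f_w(1) = 0`, `f_w(g₀) = 1`**, cover-free — it exists iff `θ(s) = τ(g₀ s g₀⁻¹)` on `K ∩ g₀⁻¹Hg₀`, i.e. in BRANCH B (`w₀ ∈ W_χ`; print:
`χ₁(u·σu) = 1` on units, the leaf's `hB`). [cite: Roche1998, §3–§4] [cite: Casselman1995, §6.3] -/
theorem exists_typeVector_supported_weyl_of_cells (K : Subgroup G) (hKo : IsOpen (K : Set G)) (θ : G → ℂ)
    (hθmul : ∀ x ∈ K, ∀ y ∈ K, θ (x * y) = θ x * θ y) (hθone : θ 1 = 1)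
    (C : Subgroup G) (hCo : IsOpen (C : Set G)) (hθC : ∀ c ∈ C, θ c = 1)
    (g₀ : G) (hg₀ : ¬ ∃ h ∈ H, ∃ b ∈ K, g₀ = h * b)
    (hθw : ∀ (s : G), s ∈ K → ∀ hsH : g₀ * s * g₀⁻¹ ∈ H, θ s = τ ⟨g₀ * s * g₀⁻¹, hsH⟩ 1) :
    ∃ f_w : Representation.SmoothInd H τ, (∀ x ∈ K, Representation.smoothIndRep H τ x f_w = θ x • f_w) ∧ f_w.toFun 1 = 0 ∧ f_w.toFun g₀ = 1 :=
  exists_typeVector_of_local_of_cells H τ K hKo θ hθmul hθone C hCo hθC g₀ hg₀ 0 1 (fun _ _ _ => by rw [zero_mul, zero_mul])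
    (fun s hs hsH => by rw [hθw s hs hsH])

/-- **THE NORMALISED `(K, θ)`-TYPE BASIS `(f₁, f_w)` IN BRANCH B, COVER-FREE** — `f₁(1) = 1, f₁(g₀) = 0, f_w(1) = 0, f_w(g₀) = 1`, both `(K, θ)`-eigen, for ANY open `K` (in
particular a two-depth level group `J_e` with its infinitely many `(P, J_e)`-cells); with ★ (B-0) `eq_smul_add_smul_of_eigen_of_cells` every `(K, θ)`-type vector vanishing on the
irrelevant cells is `f(1)·f₁ + f(g₀)·f_w`. [cite: Roche1998, §3–§4] [cite: Casselman1995, §6.3] [cite: BernsteinZelevinsky1977, §2.3] -/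
theorem exists_normalised_typeBasis_of_cells (K : Subgroup G) (hKo : IsOpen (K : Set G)) (θ : G → ℂ)
    (hθmul : ∀ x ∈ K, ∀ y ∈ K, θ (x * y) = θ x * θ y) (hθone : θ 1 = 1)
    (C : Subgroup G) (hCo : IsOpen (C : Set G)) (hθC : ∀ c ∈ C, θ c = 1)
    (g₀ : G) (hg₀ : ¬ ∃ h ∈ H, ∃ b ∈ K, g₀ = h * b)
    (hθH : ∀ (s : G), s ∈ K → ∀ hsH : s ∈ H, θ s = τ ⟨s, hsH⟩ 1)
    (hθw : ∀ (s : G), s ∈ K → ∀ hsH : g₀ * s * g₀⁻¹ ∈ H, θ s = τ ⟨g₀ * s * g₀⁻¹, hsH⟩ 1) :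
    ∃ f₁ f_w : Representation.SmoothInd H τ,
      (∀ x ∈ K, Representation.smoothIndRep H τ x f₁ = θ x • f₁) ∧ (∀ x ∈ K, Representation.smoothIndRep H τ x f_w = θ x • f_w) ∧
      f₁.toFun 1 = 1 ∧ f₁.toFun g₀ = 0 ∧ f_w.toFun 1 = 0 ∧ f_w.toFun g₀ = 1 := by
  obtain ⟨f₁, h₁, h11, h1g⟩ := exists_typeVector_supported_one_of_cells H τ K hKo θ hθmul hθone C hCo hθC g₀ hg₀ hθH
  obtain ⟨f_w, hw, hw1, hwg⟩ := exists_typeVector_supported_weyl_of_cells H τ K hKo θ hθmul hθone C hCo hθC g₀ hg₀ hθw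
  exact ⟨f₁, f_w, h₁, hw, h11, h1g, hw1, hwg⟩

end Summit.HodgeConjecture.HodgeConjecture.R90.S1.BposTypeBasisCells

end
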